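import Mathlib
import Summits.ValiantsHypothesis.ValiantsHypothesis.Theorems.TriangularDimersDivisionEasy.Negative.LowerBound

/-!
# Crux `DivisionGap.ZeroOneTransfer` (stmt-ValiantsHypothesis-5066), line `charged-uncharged` —
stub `stub_blockRestriction` (D1, BLOCK RESTRICTION of the rhombus dimer polynomial `D_n = triPM n`)

Substituting, in `D_n = Σ_{f ∈ dimers n} Π_v x_(v, f v)`, the variable `x_(a,b)` by `1` when `a` lies
outside an aligned `m`-block `B = [p m, p m + m) × [q m, q m + m)`, by `0` when `a ∈ B`, `b ∉ B`, and by
the block-local variable `x_(a - (pm,qm), b - (pm,qm))` of `D_m` when `a, b ∈ B`, yields `c • D_m` with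
`c ≠ 0`, provided the complement of `B` carries a dimer cover; `c` is the number of such covers.

Proof.  The term of `f` survives iff `f` maps `B` into `B` (an involution then maps `Bᶜ` into `Bᶜ`);
surviving covers are in bijection (glue / restrict) with pairs (cover of `B ≅ R_m`, cover of `Bᶜ` in
normal form = the identity on `B`), and the surviving term of `f` is the `D_m`-term of its block part.
The combinatorics is done for an abstract block (`BlockRestriction.exists_smul`: a decidable predicate
`P`, a chart `τ : Vtx n → Vtx m` and a parametrisation `σ : Vtx m → Vtx n` of the block, inverse to
each other on the block, `σ` transporting adjacency); the registered statement is the instance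
`P =` the aligned block, `τ =` subtraction of the corner `(pm, qm)`, `σ =` its addition.
[folklore]
-/

open MvPolynomial
open Literature.Computability.AlgebraicComplexity
open Summit.ValiantsHypothesis.ValiantsHypothesis.Theorems.TriangularDimersDivisionEasy.Negative
open scoped NNReal BigOperators
set_option linter.dupNamespace false
noncomputable section

namespace Summit.ValiantsHypothesis.ValiantsHypothesis.Theorems.DivisionGapZeroOneTransfer

namespace BlockRestriction

variable {n m : ℕ} {P : Vtx n → Prop} {τ : Vtx n → Vtx m} {σ : Vtx m → Vtx n}

/-- Membership in `dimers`. [folklore] -/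
theorem mem_dimers_iff {k : ℕ} {f : Vtx k → Vtx k} : f ∈ dimers k ↔ IsDimer f := by
  simp [dimers]

/-- A cover mapping the block into the block maps the complement into the complement. [folklore] -/
theorem not_mem_of_good {f : Vtx n → Vtx n} (hd : IsDimer f) (hf : ∀ v, P v → P (f v)) {v : Vtx n}
    (hv : ¬ P v) : ¬ P (f v) := fun hfv => hv (by simpa [(hd v).1] using hf (f v) hfv)

/-- The block part `w ↦ τ (f (σ w))` of a cover mapping the block into itself is a dimer cover of
`R_m`. [folklore] -/
theorem restrict_mem_dimers (hσP : ∀ w, P (σ w)) (hτσ : ∀ w, τ (σ w) = w)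
    (hστ : ∀ v, P v → σ (τ v) = v) (hAdj : ∀ x y, Adj (σ x) (σ y) ↔ Adj x y) {f : Vtx n → Vtx n}
    (hd : IsDimer f) (hg : ∀ v, P v → P (f v)) : (fun w => τ (f (σ w))) ∈ dimers m := by
  rw [mem_dimers_iff]
  intro w
  obtain ⟨h1, h2, h3⟩ := hd (σ w)
  have hfv : P (f (σ w)) := hg _ (hσP w)
  refine ⟨?_, ?_, ?_⟩
  · simp only [hστ _ hfv, h1, hτσ]
  · intro h
    apply h2
    have := congrArg σ h
    rwa [hστ _ hfv] at this
  · rw [← hAdj, hστ _ hfv]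
    exact h3

/-- Gluing a dimer cover `a` of `R_m` (placed on the block by the chart) with a complement cover `h`
in normal form gives a dimer cover of `R_n`. [folklore] -/
theorem isDimer_glue [DecidablePred P] (hσP : ∀ w, P (σ w)) (hτσ : ∀ w, τ (σ w) = w)
    (hστ : ∀ v, P v → σ (τ v) = v) (hAdj : ∀ x y, Adj (σ x) (σ y) ↔ Adj x y) {a : Vtx m → Vtx m}
    {h : Vtx n → Vtx n} (ha : IsDimer a)
    (hh : ∀ v, ¬ P v → h (h v) = v ∧ h v ≠ v ∧ Adj v (h v) ∧ ¬ P (h v)) :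
    IsDimer (fun v => if P v then σ (a (τ v)) else h v) := by
  intro v
  by_cases hv : P v
  · have hu : P (σ (a (τ v))) := hσP _
    obtain ⟨h1, h2, h3⟩ := ha (τ v)
    refine ⟨?_, ?_, ?_⟩
    · simp only [if_pos hv, if_pos hu, hτσ, h1, hστ _ hv]
    · intro heq
      simp only [if_pos hv] at heq
      apply h2
      have := congrArg τ heq
      rwa [hτσ] at this
    · have hA : Adj (σ (τ v)) (σ (a (τ v))) := (hAdj _ _).2 h3
      rw [hστ _ hv] at hA
      simpa only [if_pos hv] using hA
  · obtain ⟨h1, h2, h3, h4⟩ := hh v hv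
    refine ⟨?_, ?_, ?_⟩
    · simp only [if_neg hv, if_neg h4, h1]
    · simpa only [if_neg hv] using h2
    · simpa only [if_neg hv] using h3

/-- **Counting.**  For `G` = the dimer covers of `R_n` mapping the block into itself and `C` = the
complement covers in normal form (identity on the block): summing a function of the block part over
`G` gives `#C •` its sum over the dimer covers of `R_m` — via the bijection `G ≃ dimers m × C`,
`f ↦ (block part, complement part)`, inverse = gluing. [folklore] -/
theorem sum_good_eq_card_smul [DecidablePred P] (hσP : ∀ w, P (σ w)) (hτσ : ∀ w, τ (σ w) = w)
    (hστ : ∀ v, P v → σ (τ v) = v) (hAdj : ∀ x y, Adj (σ x) (σ y) ↔ Adj x y)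
    {G C : Finset (Vtx n → Vtx n)} (hG : ∀ f, f ∈ G ↔ IsDimer f ∧ ∀ v, P v → P (f v))
    (hC : ∀ h, h ∈ C ↔ ∀ v, (P v → h v = v) ∧ (¬ P v → h (h v) = v ∧ h v ≠ v ∧ Adj v (h v) ∧ ¬ P (h v)))
    {M : Type*} [AddCommMonoid M] (F : (Vtx m → Vtx m) → M) :
    ∑ f ∈ G, F (fun w => τ (f (σ w))) = C.card • ∑ a ∈ dimers m, F a := by
  rw [Finset.smul_sum]
  have hc : ∀ a ∈ dimers m, C.card • F a = ∑ _h ∈ C, F a := fun a _ => by rw [Finset.sum_const]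
  rw [Finset.sum_congr rfl hc, ← Finset.sum_product (dimers m) C (fun x => F x.1)]
  refine Finset.sum_nbij' (fun f => ((fun w => τ (f (σ w))), fun v => if P v then v else f v))
    (fun x => fun v => if P v then σ (x.1 (τ v)) else x.2 v)
    (fun f hf => ?_) (fun x hx => ?_) (fun f hf => ?_) (fun x hx => ?_) (fun f _ => rfl)
  · -- restriction lands in the product
    obtain ⟨hd, hg⟩ := (hG f).1 hf
    refine Finset.mem_product.2 ⟨restrict_mem_dimers hσP hτσ hστ hAdj hd hg, (hC _).2 fun v => ?_⟩
    refine ⟨fun hv => if_pos hv, fun hv => ?_⟩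
    have hfv : ¬ P (f v) := not_mem_of_good hd hg hv
    obtain ⟨h1, h2, h3⟩ := hd v
    simp only [if_neg hv, if_neg hfv]
    exact ⟨h1, h2, h3, hfv⟩
  · -- gluing lands in `G`
    obtain ⟨ha, hh⟩ := Finset.mem_product.1 hx
    refine (hG _).2 ⟨isDimer_glue hσP hτσ hστ hAdj (mem_dimers_iff.1 ha)
      (fun v hv => ((hC _).1 hh v).2 hv), fun v hv => ?_⟩
    simp only [if_pos hv]
    exact hσP _
  · -- glue ∘ restrict = id on `G`
    obtain ⟨-, hg⟩ := (hG f).1 hf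
    funext v
    by_cases hv : P v
    · simp only [if_pos hv, hστ _ hv, hστ _ (hg v hv)]
    · simp only [if_neg hv]
  · -- restrict ∘ glue = id on the product
    obtain ⟨-, hh⟩ := Finset.mem_product.1 hx
    refine Prod.ext (funext fun w => ?_) (funext fun v => ?_)
    · simp only [if_pos (hσP w), hτσ]
    · by_cases hv : P v
      · simp only [if_pos hv, ((hC _).1 hh v).1 hv]
      · simp only [if_neg hv]

/-- The surviving term of a cover mapping the block into itself is the `D_m`-term of its block part
(reindex the product over the block by the chart). [folklore] -/
theorem prod_subst_eq [DecidablePred P] (hσP : ∀ w, P (σ w)) (hτσ : ∀ w, τ (σ w) = w)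
    (hστ : ∀ v, P v → σ (τ v) = v) (f : Vtx n → Vtx n) (hf : ∀ v, P v → P (f v)) :
    ∏ v, (if P v then (if P (f v) then (X (τ v, τ (f v)) : MvPolynomial (Var m) ℝ≥0) else 0)
      else 1) = ∏ w, (X (w, τ (f (σ w))) : MvPolynomial (Var m) ℝ≥0) := by
  have h1 : ∏ v, (if P v then (if P (f v) then (X (τ v, τ (f v)) : MvPolynomial (Var m) ℝ≥0)
      else 0) else 1) = ∏ v ∈ Finset.univ.filter P, (X (τ v, τ (f v)) : MvPolynomial (Var m) ℝ≥0) := by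
    rw [Finset.prod_filter]
    refine Finset.prod_congr rfl fun v _ => ?_
    by_cases hv : P v
    · simp [hv, hf v hv]
    · simp [hv]
  rw [h1]
  symm
  refine Finset.prod_nbij' σ τ (fun w _ => ?_) (fun v _ => Finset.mem_univ _) (fun w _ => hτσ w)
    (fun v hv => hστ v (Finset.mem_filter.1 hv).2) (fun w _ => ?_)
  · exact Finset.mem_filter.2 ⟨Finset.mem_univ _, hσP w⟩
  · simp only [hτσ]

/-- The term of a cover not mapping the block into itself vanishes. [folklore] -/
theorem prod_subst_eq_zero [DecidablePred P] (f : Vtx n → Vtx n) (hf : ¬ ∀ v, P v → P (f v)) :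
    ∏ v, (if P v then (if P (f v) then (X (τ v, τ (f v)) : MvPolynomial (Var m) ℝ≥0) else 0)
      else 1) = 0 := by
  push Not at hf
  obtain ⟨v, hv, hfv⟩ := hf
  exact Finset.prod_eq_zero (Finset.mem_univ v) (by simp [hv, hfv])

/-- **Block restriction, abstract form.**  For a decidable block `P` with a chart `τ` and a
parametrisation `σ` (inverse to each other on the block, `σ` transporting adjacency), if the
complement of the block has a dimer cover then the block substitution maps `D_n` to `c • D_m`,
`c ≠ 0` the number of complement covers. [folklore] -/
theorem exists_smul (P : Vtx n → Prop) [DecidablePred P] (τ : Vtx n → Vtx m) (σ : Vtx m → Vtx n)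
    (hσP : ∀ w, P (σ w)) (hτσ : ∀ w, τ (σ w) = w) (hστ : ∀ v, P v → σ (τ v) = v)
    (hAdj : ∀ x y, Adj (σ x) (σ y) ↔ Adj x y)
    (hg : ∃ g : Vtx n → Vtx n, ∀ v, ¬ P v → g (g v) = v ∧ g v ≠ v ∧ Adj v (g v) ∧ ¬ P (g v)) :
    ∃ c : ℝ≥0, c ≠ 0 ∧
      MvPolynomial.aeval (fun e : Var n =>
        if P e.1 then (if P e.2 then (X (τ e.1, τ e.2) : MvPolynomial (Var m) ℝ≥0) else 0) else 1)
        (triPM n) = c • triPM m := by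
  -- the surviving covers and the complement covers in normal form
  set G : Finset (Vtx n → Vtx n) := (dimers n).filter fun f => ∀ v, P v → P (f v) with hGdef
  set C : Finset (Vtx n → Vtx n) := Finset.univ.filter fun h =>
    ∀ v, (P v → h v = v) ∧ (¬ P v → h (h v) = v ∧ h v ≠ v ∧ Adj v (h v) ∧ ¬ P (h v)) with hCdef
  have hG : ∀ f, f ∈ G ↔ IsDimer f ∧ ∀ v, P v → P (f v) := fun f => by
    rw [hGdef, Finset.mem_filter, mem_dimers_iff]
  have hC : ∀ h, h ∈ C ↔
      ∀ v, (P v → h v = v) ∧ (¬ P v → h (h v) = v ∧ h v ≠ v ∧ Adj v (h v) ∧ ¬ P (h v)) := fun h => by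
    rw [hCdef, Finset.mem_filter]
    exact ⟨fun h => h.2, fun h => ⟨Finset.mem_univ _, h⟩⟩
  -- `C` is nonempty: normalise the given complement cover to the identity on the block
  have hCpos : 0 < C.card := by
    obtain ⟨g, hg⟩ := hg
    refine Finset.card_pos.2 ⟨fun v => if P v then v else g v, (hC _).2 fun v => ⟨fun hv => if_pos hv,
      fun hv => ?_⟩⟩
    obtain ⟨h1, h2, h3, h4⟩ := hg v hv
    simp only [if_neg hv, if_neg h4]
    exact ⟨h1, h2, h3, h4⟩
  refine ⟨C.card, Nat.cast_ne_zero.2 hCpos.ne', ?_⟩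
  calc MvPolynomial.aeval (fun e : Var n => if P e.1 then
          (if P e.2 then (X (τ e.1, τ e.2) : MvPolynomial (Var m) ℝ≥0) else 0) else 1) (triPM n)
      = ∑ f ∈ dimers n, ∏ v, (if P v then
          (if P (f v) then (X (τ v, τ (f v)) : MvPolynomial (Var m) ℝ≥0) else 0) else 1) := by
        rw [triPM, map_sum]
        refine Finset.sum_congr rfl fun f _ => ?_
        simp only [map_prod, MvPolynomial.aeval_X]
    _ = ∑ f ∈ G, ∏ v, (if P v then
          (if P (f v) then (X (τ v, τ (f v)) : MvPolynomial (Var m) ℝ≥0) else 0) else 1) :=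
        (Finset.sum_filter_of_ne fun f _ hne => not_not.1 fun h => hne (prod_subst_eq_zero f h)).symm
    _ = ∑ f ∈ G, ∏ w, (X (w, τ (f (σ w))) : MvPolynomial (Var m) ℝ≥0) :=
        Finset.sum_congr rfl fun f hf => prod_subst_eq hσP hτσ hστ f ((hG f).1 hf).2
    _ = C.card • ∑ a ∈ dimers m, ∏ w, (X (w, a w) : MvPolynomial (Var m) ℝ≥0) :=
        sum_good_eq_card_smul hσP hτσ hστ hAdj hG hC fun a => ∏ w, (X (w, a w) : MvPolynomial (Var m) ℝ≥0)
    _ = (C.card : ℝ≥0) • triPM m := by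
        rw [Nat.cast_smul_eq_nsmul]
        rfl

end BlockRestriction

/-- **Stub D1 — BLOCK RESTRICTION.**  Substituting, in `D_n`, the variable `x_(a,b)` by `1` when `a`
lies outside the aligned `m`-block `B = [p m, p m + m) × [q m, q m + m)`, by `0` when `a ∈ B`, `b ∉ B`,
and by the block-local variable `x_(a - (pm,qm), b - (pm,qm))` of `D_m` when `a, b ∈ B`, yields
`c • D_m` with `c ≠ 0` — provided the complement of the block carries a dimer cover (`c` = the number
of such covers: a cover of `R_n` survives iff it maps `B` into `B`, and then splits as a cover of `B ≅ R_m`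
and one of the complement).  Instance of `BlockRestriction.exists_smul` with the chart "subtract the
corner `(pm, qm)`" and the parametrisation "add the corner" (translation preserves the six adjacency
disjuncts, which are relations between ℕ-coordinates). [folklore] -/
theorem stub_blockRestriction :
    ∀ (n m p q : ℕ) (hm : 0 < m), p * m + m ≤ n → q * m + m ≤ n →
      (∃ g : Fin n × Fin n → Fin n × Fin n, ∀ v : Fin n × Fin n,
        ¬ ((p * m ≤ (v.1 : ℕ) ∧ (v.1 : ℕ) < p * m + m) ∧ (q * m ≤ (v.2 : ℕ) ∧ (v.2 : ℕ) < q * m + m)) →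
          g (g v) = v ∧ g v ≠ v ∧ Adj v (g v) ∧
          ¬ ((p * m ≤ ((g v).1 : ℕ) ∧ ((g v).1 : ℕ) < p * m + m) ∧
             (q * m ≤ ((g v).2 : ℕ) ∧ ((g v).2 : ℕ) < q * m + m))) →
      ∃ c : ℝ≥0, c ≠ 0 ∧
        MvPolynomial.aeval (fun e : (Fin n × Fin n) × (Fin n × Fin n) =>
          if (p * m ≤ (e.1.1 : ℕ) ∧ (e.1.1 : ℕ) < p * m + m) ∧ (q * m ≤ (e.1.2 : ℕ) ∧ (e.1.2 : ℕ) < q * m + m) then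
            (if (p * m ≤ (e.2.1 : ℕ) ∧ (e.2.1 : ℕ) < p * m + m) ∧ (q * m ≤ (e.2.2 : ℕ) ∧ (e.2.2 : ℕ) < q * m + m) then
              (MvPolynomial.X ((⟨((e.1.1 : ℕ) - p * m) % m, Nat.mod_lt _ hm⟩, ⟨((e.1.2 : ℕ) - q * m) % m, Nat.mod_lt _ hm⟩),
                  (⟨((e.2.1 : ℕ) - p * m) % m, Nat.mod_lt _ hm⟩, ⟨((e.2.2 : ℕ) - q * m) % m, Nat.mod_lt _ hm⟩)) :
                MvPolynomial ((Fin m × Fin m) × (Fin m × Fin m)) ℝ≥0)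
            else 0)
          else 1) (triPM n) = c • triPM m := by
  intro n m p q hm hp hq hg
  refine BlockRestriction.exists_smul
    (fun v : Vtx n => (p * m ≤ (v.1 : ℕ) ∧ (v.1 : ℕ) < p * m + m) ∧ (q * m ≤ (v.2 : ℕ) ∧ (v.2 : ℕ) < q * m + m))
    (fun v : Vtx n => ((⟨((v.1 : ℕ) - p * m) % m, Nat.mod_lt _ hm⟩ : Fin m),
      (⟨((v.2 : ℕ) - q * m) % m, Nat.mod_lt _ hm⟩ : Fin m)))
    (fun w : Vtx m => ((⟨p * m + (w.1 : ℕ), by have := w.1.isLt; omega⟩ : Fin n),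
      (⟨q * m + (w.2 : ℕ), by have := w.2.isLt; omega⟩ : Fin n)))
    (fun w => ?_) (fun w => ?_) (fun v hv => ?_) (fun x y => ?_) hg
  · -- the parametrisation lands in the block
    have h1 := w.1.isLt
    have h2 := w.2.isLt
    dsimp only
    omega
  · -- chart ∘ parametrisation = id
    refine Prod.ext (Fin.ext ?_) (Fin.ext ?_)
    · show (p * m + (w.1 : ℕ) - p * m) % m = w.1
      rw [Nat.add_sub_cancel_left, Nat.mod_eq_of_lt w.1.isLt]
    · show (q * m + (w.2 : ℕ) - q * m) % m = w.2
      rw [Nat.add_sub_cancel_left, Nat.mod_eq_of_lt w.2.isLt]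
  · -- parametrisation ∘ chart = id on the block
    have h1 : ((v.1 : ℕ) - p * m) % m = (v.1 : ℕ) - p * m := Nat.mod_eq_of_lt (by omega)
    have h2 : ((v.2 : ℕ) - q * m) % m = (v.2 : ℕ) - q * m := Nat.mod_eq_of_lt (by omega)
    refine Prod.ext (Fin.ext ?_) (Fin.ext ?_)
    · show p * m + ((v.1 : ℕ) - p * m) % m = v.1
      omega
    · show q * m + ((v.2 : ℕ) - q * m) % m = v.2
      omega
  · -- translation preserves adjacency
    simp only [Adj]
    omega

end Summit.ValiantsHypothesis.ValiantsHypothesis.Theorems.DivisionGapZeroOneTransfer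

end
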